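import Literature.Analysis.UnboundedOperators.LinearMildFlowSmall
import HarnessLib

/-!
# The linear mild flow `w(t) = T(t) h − ∫₀ᵗ K(t − s) B(s) w(s) ds`: solution operators, norm continuity
# in time, Lipschitz dependence on the coefficients

Analysis/UnboundedOperators support file (theorems only, everything proved, no named facts, no
definitions).  Let `E` be a real Banach space, `T(t)` (`t ≥ 0`) strongly continuous contractions which
are norm continuous on `(0, ∞)`, `K(t)` (`t > 0`) bounded operators, strongly and norm continuous on
`(0, ∞)`, with the weakly singular bound `‖K(t)‖ ≤ C t^{-α}`, `0 ≤ α < 1` (the abstract analytic semigroup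
`e^{-tA}` and its fractional smoothing `A^α e^{-tA}`: D. Henry, *Geometric Theory of Semilinear Parabolic
Equations*, LNM 840 (1981), Thm 1.4.3), `τ > 0` and `β ≥ 0`.  For every coefficient family
`B : [0, τ] → L(E)`, norm continuous with `‖B(s)‖ ≤ β`, the linear mild (Volterra) equation

  `w(t) = T(t) h − ∫₀ᵗ K(t − s) B(s) w(s) ds`     (`0 ≤ t ≤ τ`),

the mild form of `w' + A w + A^α B(t) w = 0`, `w(0) = h` (Henry 1981, §7.1; with
`B(s) = N(y(s), ·) + N(·, y(s))` it is the linearisation of `y' + Ay + N(y, y) = f` along a mild solution,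
Henry 1981 Thm 3.4.4 / Cor. 3.4.6), has unique solution operators `W(t) ∈ L(E)`
(`exists_linearMildFlow`): the equation `W(t) h = T(t) h − ∫₀ᵗ K(t − s) B(s) W(s) h ds`, continuity of
`t ↦ W(t) h`, uniqueness among continuous solutions, a bound `‖W(t)‖ ≤ C_W`, **continuity of `t ↦ W(t)`
in operator norm on `(0, τ]`**, and **Lipschitz dependence on the coefficients**,
`‖W_B(t) − W_{B'}(t)‖ ≤ L sup ‖B − B'‖`, with `C_W`, `L` depending on `(α, C, τ, β)` only.

Classically (Henry 1981, Thm 3.3.3, Thm 3.4.1, Lemma 7.1.1) existence is by Picard iteration and the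
bounds by the singular Grönwall inequality.  Here the whole statement is reduced to the short-interval /
small-coefficient case `exists_linearMildFlow_of_small` (`LinearMildFlowSmall.lean`, a Neumann series on
`C([0, τ]; E)`) by the **exponential weight**: `v(t) = e^{-γt} w(t)` solves the same equation for the pair
`T_γ(t) = e^{-γt} T(t)`, `K_γ(t) = e^{-γt} K(t)` (`integral_duhamel_exp_weight`), and
`‖K_γ(t)‖ ≤ C e^{-γt} t^{-α} ≤ C γ^{-p} t^{-(α + p)}` with `p = (1 − α)/2` (`norm_exp_smul_le`, from
`x^p ≤ eˣ`), so that the smallness `C γ^{-p} τ^{1−α−p} β/(1 − α − p) ≤ 1/2` holds for `γ` large; the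
constants pick up the factor `e^{γτ}`.  This is the equivalent-norm form of Henry's Lemma 7.1.1.

## References

* D. Henry, *Geometric Theory of Semilinear Parabolic Equations*, LNM 840, Springer (1981), Thm 1.4.3,
  Thm 3.3.3, Thm 3.4.1, Thm 3.4.4, Cor. 3.4.6, §7.1 (Lemma 7.1.1). [Henry1981]
* A. Pazy, *Semigroups of Linear Operators and Applications to Partial Differential Equations*,
  Springer (1983), §5.6, §6.3 Thm 6.3.1. [Pazy1983]
-/

noncomputable section

open MeasureTheory Set Filter intervalIntegral
open _root_.Topology

namespace Literature.Analysis.UnboundedOperators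

variable {E F : Type*} [NormedAddCommGroup E] [NormedSpace ℝ E] [NormedAddCommGroup F]
  [NormedSpace ℝ F]

/-! ### The exponential weight -/

/-- `x^p ≤ eˣ` for `x ≥ 0` and `0 ≤ p ≤ 1` (`x^p ≤ max(1, x) ≤ x + 1 ≤ eˣ`). [folklore] -/
theorem rpow_le_exp_of_exponent_le_one {x p : ℝ} (hx : 0 ≤ x) (hp0 : 0 ≤ p) (hp1 : p ≤ 1) :
    x ^ p ≤ Real.exp x := by
  rcases le_total x 1 with h | h
  · exact (Real.rpow_le_one hx h hp0).trans (Real.one_le_exp hx)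
  · calc x ^ p ≤ x ^ (1 : ℝ) := Real.rpow_le_rpow_of_exponent_le h hp1
      _ = x := Real.rpow_one x
      _ ≤ x + 1 := le_add_of_nonneg_right zero_le_one
      _ ≤ Real.exp x := Real.add_one_le_exp x

/-- The exponential weight beats a small power: `e^{-γu} u^p ≤ γ^{-p}` for `γ, u > 0` and `0 ≤ p ≤ 1`
(substitute `x = γu` in `x^p ≤ eˣ`). [folklore] -/
theorem exp_neg_mul_mul_rpow_le {γ u p : ℝ} (hγ : 0 < γ) (hu : 0 < u) (hp0 : 0 ≤ p) (hp1 : p ≤ 1) :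
    Real.exp (-(γ * u)) * u ^ p ≤ γ ^ (-p) := by
  have h1 : (γ * u) ^ p ≤ Real.exp (γ * u) :=
    rpow_le_exp_of_exponent_le_one (mul_pos hγ hu).le hp0 hp1
  rw [Real.mul_rpow hγ.le hu.le] at h1
  have hγp : 0 < γ ^ p := Real.rpow_pos_of_pos hγ p
  rw [Real.rpow_neg hγ.le, Real.exp_neg, inv_mul_le_iff₀ (Real.exp_pos _), le_mul_inv_iff₀ hγp]
  calc u ^ p * γ ^ p = γ ^ p * u ^ p := mul_comm _ _
    _ ≤ Real.exp (γ * u) := h1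

/-- **The weighted kernel is weakly singular with a small constant**: if `‖K(t)‖ ≤ C t^{-α}` then
`‖e^{-γt} K(t)‖ ≤ C γ^{-p} t^{-(α + p)}` for `t > 0` (`γ > 0`, `0 ≤ p ≤ 1`, `C ≥ 0`); with `p < 1 − α`
the exponent stays integrable while the constant `C γ^{-p}` tends to `0` as `γ → ∞`. [folklore] -/
theorem norm_exp_smul_le {α C γ p : ℝ} {K : ℝ → E →L[ℝ] F} (hC : 0 ≤ C)
    (hK : ∀ t, 0 < t → ‖K t‖ ≤ C * t ^ (-α)) (hγ : 0 < γ) (hp0 : 0 ≤ p) (hp1 : p ≤ 1) {t : ℝ}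
    (ht : 0 < t) : ‖Real.exp (-(γ * t)) • K t‖ ≤ C * γ ^ (-p) * t ^ (-(α + p)) := by
  rw [norm_smul, Real.norm_eq_abs, abs_of_pos (Real.exp_pos _)]
  have h1 : t ^ (-α) = t ^ p * t ^ (-(α + p)) := by
    rw [← Real.rpow_add ht]
    congr 1
    ring
  calc Real.exp (-(γ * t)) * ‖K t‖ ≤ Real.exp (-(γ * t)) * (C * t ^ (-α)) :=
        mul_le_mul_of_nonneg_left (hK t ht) (Real.exp_pos _).le
    _ = C * (Real.exp (-(γ * t)) * t ^ p) * t ^ (-(α + p)) := by rw [h1]; ring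
    _ ≤ C * γ ^ (-p) * t ^ (-(α + p)) :=
        mul_le_mul_of_nonneg_right
          (mul_le_mul_of_nonneg_left (exp_neg_mul_mul_rpow_le hγ ht hp0 hp1) hC)
          (Real.rpow_nonneg ht.le _)

/-- **Conjugation of the Duhamel integral by the exponential weight**:
`∫₀ᵗ (e^{-γ(t−s)} K(t − s)) (B(s) (e^{-γs} w(s))) ds = e^{-γt} ∫₀ᵗ K(t − s) B(s) w(s) ds` — the weighted
curve `e^{-γt} w(t)` satisfies the mild equation with the weighted kernel `e^{-γt} K(t)` (pointwise
`e^{-γ(t−s)} e^{-γs} = e^{-γt}`; no integrability is needed). [folklore] -/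
theorem integral_duhamel_exp_weight (K : ℝ → F →L[ℝ] E) (B : ℝ → E →L[ℝ] F) (w : ℝ → E)
    (γ t : ℝ) :
    ∫ s in (0 : ℝ)..t, (Real.exp (-(γ * (t - s))) • K (t - s)) (B s (Real.exp (-(γ * s)) • w s)) =
      Real.exp (-(γ * t)) • ∫ s in (0 : ℝ)..t, K (t - s) (B s (w s)) := by
  rw [← intervalIntegral.integral_smul]
  refine intervalIntegral.integral_congr fun s _ => ?_
  simp only [smul_apply, map_smul, smul_smul]
  congr 1
  rw [← Real.exp_add]
  congr 1
  ring

/-! ### The linear mild flow -/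

/-- **The linear mild flow: solution operators, operator-norm continuity in time and Lipschitz
dependence on the coefficients** (Henry 1981, §7.1 with Thm 3.3.3, Thm 3.4.1 and Lemma 7.1.1; Pazy 1983,
§5.6).  Let `E` be a real Banach space, `T(t)` strongly continuous contractions, norm continuous on
`(0, ∞)`, `K(t)` strongly and norm continuous on `(0, ∞)` with `‖K(t)‖ ≤ C t^{-α}` (`C ≥ 0`,
`0 ≤ α < 1`), `τ > 0`, `β ≥ 0`.  There are constants `C_W`, `L` such that for every coefficient family
`B`, norm continuous on `[0, τ]` with `‖B(s)‖ ≤ β`, there are `W(t) ∈ L(E)` with: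
`W(t) h = T(t) h − ∫₀ᵗ K(t − s) B(s) W(s) h ds` on `[0, τ]`; `t ↦ W(t) h` continuous on `[0, τ]`; every
continuous solution of the equation equals `W(·) h`; `‖W(t)‖ ≤ C_W` on `[0, τ]`; `t ↦ W(t)` continuous on
`(0, τ]` in operator norm; and for every second family `B'` (`‖B'‖ ≤ β`, `‖B − B'‖ ≤ η` on `[0, τ]`)
and every family `W'` of solution operators for `B'` with `t ↦ W'(t) h` continuous,
`‖W(t) − W'(t)‖ ≤ L η` on `[0, τ]`.  Proof: exponential weight `e^{-γt}` and the small case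
`exists_linearMildFlow_of_small` (see the module docstring). [cite: Henry1981, Lemma 7.1.1 and Thm 3.4.1] -/
theorem exists_linearMildFlow [CompleteSpace E] (T K : ℝ → E →L[ℝ] E)
    (hTnorm : ∀ t, 0 ≤ t → ‖T t‖ ≤ 1) (hTc : ∀ y : E, Continuous fun t : ℝ => T t y)
    (hTn : ContinuousOn T (Ioi 0)) {α C : ℝ} (hα₀ : 0 ≤ α) (hα : α < 1) (hC : 0 ≤ C)
    (hK : ∀ t, 0 < t → ‖K t‖ ≤ C * t ^ (-α))
    (hKc : ∀ y : E, ContinuousOn (fun t : ℝ => K t y) (Ioi 0)) (hKn : ContinuousOn K (Ioi 0))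
    {τ β : ℝ} (hτ : 0 < τ) (hβ : 0 ≤ β) :
    ∃ C_W L : ℝ, ∀ (B : ℝ → E →L[ℝ] E), ContinuousOn B (Icc 0 τ) → (∀ s ∈ Icc 0 τ, ‖B s‖ ≤ β) →
      ∃ W : ℝ → E →L[ℝ] E,
        (∀ (h : E) (t : Icc (0 : ℝ) τ), W t h = T t h -
          ∫ s in (0 : ℝ)..(t : ℝ), K ((t : ℝ) - s) (B s (W s h))) ∧
        (∀ h : E, ContinuousOn (fun t : ℝ => W t h) (Icc 0 τ)) ∧
        (∀ (h : E) (z : C(Icc (0 : ℝ) τ, E)), (∀ t : Icc (0 : ℝ) τ, z t = T t h -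
          ∫ s in (0 : ℝ)..(t : ℝ), K ((t : ℝ) - s) (B s (z (Set.projIcc 0 τ hτ.le s)))) →
          ∀ t : Icc (0 : ℝ) τ, z t = W t h) ∧
        (∀ t ∈ Icc 0 τ, ‖W t‖ ≤ C_W) ∧ ContinuousOn W (Ioc 0 τ) ∧
        ∀ (B' : ℝ → E →L[ℝ] E) (W' : ℝ → E →L[ℝ] E) (η : ℝ), ContinuousOn B' (Icc 0 τ) →
          (∀ s ∈ Icc 0 τ, ‖B' s‖ ≤ β) → (∀ s ∈ Icc 0 τ, ‖B s - B' s‖ ≤ η) →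
          (∀ (h : E) (t : Icc (0 : ℝ) τ), W' t h = T t h -
            ∫ s in (0 : ℝ)..(t : ℝ), K ((t : ℝ) - s) (B' s (W' s h))) →
          (∀ h : E, ContinuousOn (fun t : ℝ => W' t h) (Icc 0 τ)) →
          ∀ t ∈ Icc 0 τ, ‖W t - W' t‖ ≤ L * η := by
  -- ### the exponents `p`, `α' = α + p` and the weight rate `γ`
  have hα1 : 0 < 1 - α := by linarith
  set p : ℝ := (1 - α) / 2 with hp
  have hp0 : 0 < p := by positivity
  have hp1 : p ≤ 1 := by rw [hp]; linarith
  have hα'0 : 0 ≤ α + p := by positivity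
  have hα'1 : α + p < 1 := by rw [hp]; linarith
  obtain ⟨x, hx0, -, hx⟩ := exists_pos_le_mul_rpow_le (β := p)
    (M := C * τ ^ (1 - (α + p)) / (1 - (α + p)) * β) (ε := 1 / 2) (b := 1) hp0 one_half_pos one_pos
  set γ : ℝ := x⁻¹ with hγ
  have hγ0 : 0 < γ := inv_pos.2 hx0
  have hγp : γ ^ (-p) = x ^ p := by
    rw [hγ, Real.rpow_neg (inv_pos.2 hx0).le, Real.inv_rpow hx0.le, inv_inv]
  have hC'0 : 0 ≤ C * γ ^ (-p) := mul_nonneg hC (Real.rpow_nonneg hγ0.le _)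
  have hsmall : C * γ ^ (-p) * τ ^ (1 - (α + p)) / (1 - (α + p)) * β ≤ 1 / 2 := by
    calc C * γ ^ (-p) * τ ^ (1 - (α + p)) / (1 - (α + p)) * β
        = C * τ ^ (1 - (α + p)) / (1 - (α + p)) * β * x ^ p := by rw [hγp]; ring
      _ ≤ 1 / 2 := hx
  -- ### the weighted families `T_γ`, `K_γ`
  set Tγ : ℝ → E →L[ℝ] E := fun t => Real.exp (-(γ * t)) • T t with hTγ
  set Kγ : ℝ → E →L[ℝ] E := fun t => Real.exp (-(γ * t)) • K t with hKγ
  have hTγap : ∀ (t : ℝ) (h : E), Tγ t h = Real.exp (-(γ * t)) • T t h := fun t h => rfl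
  have hexpc : Continuous fun t : ℝ => Real.exp (-(γ * t)) :=
    Real.continuous_exp.comp (continuous_const.mul continuous_id).neg
  have hexpc' : Continuous fun t : ℝ => Real.exp (γ * t) :=
    Real.continuous_exp.comp (continuous_const.mul continuous_id)
  have hTγnorm : ∀ t, 0 ≤ t → ‖Tγ t‖ ≤ 1 := fun t ht => by
    rw [hTγ, norm_smul, Real.norm_eq_abs, abs_of_pos (Real.exp_pos _)]
    calc Real.exp (-(γ * t)) * ‖T t‖ ≤ 1 * 1 :=
          mul_le_mul (Real.exp_le_one_iff.2 (neg_nonpos.2 (mul_nonneg hγ0.le ht))) (hTnorm t ht)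
            (norm_nonneg _) zero_le_one
      _ = 1 := one_mul _
  have hTγc : ∀ y : E, Continuous fun t : ℝ => Tγ t y := fun y => by
    simp only [hTγap]
    exact hexpc.smul (hTc y)
  have hTγn : ContinuousOn Tγ (Ioi 0) := hexpc.continuousOn.smul hTn
  have hKγb : ∀ t, 0 < t → ‖Kγ t‖ ≤ C * γ ^ (-p) * t ^ (-(α + p)) := fun t ht =>
    norm_exp_smul_le hC hK hγ0 hp0.le hp1 ht
  have hKγc : ∀ y : E, ContinuousOn (fun t : ℝ => Kγ t y) (Ioi 0) := fun y => by
    simp only [hKγ, smul_apply]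
    exact hexpc.continuousOn.smul (hKc y)
  have hKγn : ContinuousOn Kγ (Ioi 0) := hexpc.continuousOn.smul hKn
  -- two identities of the weight
  have hee : ∀ t : ℝ, Real.exp (γ * t) * Real.exp (-(γ * t)) = 1 := fun t => by
    rw [← Real.exp_add, add_neg_cancel, Real.exp_zero]
  have heτ : ∀ t ∈ Icc (0 : ℝ) τ, Real.exp (γ * t) ≤ Real.exp (γ * τ) := fun t ht =>
    Real.exp_le_exp.2 (mul_le_mul_of_nonneg_left ht.2 hγ0.le)
  -- ### the constants and the flow
  refine ⟨Real.exp (γ * τ) * 2,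
    Real.exp (γ * τ) * (4 * (C * γ ^ (-p) * τ ^ (1 - (α + p)) / (1 - (α + p)))),
    fun B hBc hBβ => ?_⟩
  obtain ⟨Wγ, h1, h2, h3, h4, h5, h6⟩ := exists_linearMildFlow_of_small Tγ Kγ hTγnorm hTγc hTγn
    hα'0 hα'1 hC'0 hKγb hKγc hKγn hτ hβ hsmall B hBc hBβ
  set W : ℝ → E →L[ℝ] E := fun t => Real.exp (γ * t) • Wγ t with hW
  have hWop : ∀ t : ℝ, W t = Real.exp (γ * t) • Wγ t := fun t => rfl
  have hWap : ∀ (t : ℝ) (h : E), W t h = Real.exp (γ * t) • Wγ t h := fun t h => rfl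
  have hWγ : ∀ (t : ℝ) (h : E), Wγ t h = Real.exp (-(γ * t)) • W t h := fun t h => by
    rw [hWap, smul_smul, ← Real.exp_add, neg_add_cancel, Real.exp_zero, one_smul]
  refine ⟨W, fun h t => ?_, fun h => ?_, fun h z hz t => ?_, fun t ht => ?_, ?_, ?_⟩
  · -- the mild equation
    have e : (∫ s in (0 : ℝ)..(t : ℝ), Kγ ((t : ℝ) - s) (B s (Wγ s h))) =
        Real.exp (-(γ * t)) • ∫ s in (0 : ℝ)..(t : ℝ), K ((t : ℝ) - s) (B s (W s h)) := by
      rw [← integral_duhamel_exp_weight K B (fun s => W s h) γ t]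
      refine intervalIntegral.integral_congr fun s _ => ?_
      simp only [hKγ, hWγ]
    rw [hWap (t : ℝ) h, h1 h t, e, smul_sub, smul_smul, hee, one_smul, hTγap, smul_smul, hee,
      one_smul]
  · -- continuity of `t ↦ W t h`
    simp only [hWap]
    exact hexpc'.continuousOn.smul (h2 h)
  · -- uniqueness: the weighted competitor solves the weighted equation
    set zγ : C(Icc (0 : ℝ) τ, E) := ⟨fun r : Icc (0 : ℝ) τ => Real.exp (-(γ * r)) • z r,
      (hexpc.comp continuous_subtype_val).smul z.continuous⟩ with hzγ
    have hzγap : ∀ r : Icc (0 : ℝ) τ, zγ r = Real.exp (-(γ * r)) • z r := fun r => rfl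
    have hcoe : ∀ {r : ℝ}, r ≤ τ → ∀ s ∈ Icc 0 r,
        ((Set.projIcc 0 τ hτ.le s : Icc (0 : ℝ) τ) : ℝ) = s := fun hr s hs => by
      rw [Set.projIcc_of_mem hτ.le ⟨hs.1, hs.2.trans hr⟩]
    have hzγeq : ∀ r : Icc (0 : ℝ) τ, zγ r = Tγ r h -
        ∫ s in (0 : ℝ)..(r : ℝ), Kγ ((r : ℝ) - s) (B s (zγ (Set.projIcc 0 τ hτ.le s))) := by
      intro r
      have e : (∫ s in (0 : ℝ)..(r : ℝ), Kγ ((r : ℝ) - s) (B s (zγ (Set.projIcc 0 τ hτ.le s)))) =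
          Real.exp (-(γ * r)) •
            ∫ s in (0 : ℝ)..(r : ℝ), K ((r : ℝ) - s) (B s (z (Set.projIcc 0 τ hτ.le s))) := by
        rw [← integral_duhamel_exp_weight K B (fun s => z (Set.projIcc 0 τ hτ.le s)) γ r]
        refine intervalIntegral.integral_congr fun s hs => ?_
        rw [uIcc_of_le r.2.1] at hs
        simp only [hKγ, hzγap]
        rw [hcoe r.2.2 s hs]
      rw [e, hzγap, hz r, smul_sub, hTγap]
    have key := h3 h zγ hzγeq t
    rw [hzγap, hWγ] at key
    exact smul_right_injective E (Real.exp_pos _).ne' key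
  · -- the bound `‖W t‖ ≤ e^{γτ} 2`
    rw [hWop t, norm_smul, Real.norm_eq_abs, abs_of_pos (Real.exp_pos _)]
    exact mul_le_mul (heτ t ht) (h4 t ht) (norm_nonneg _) (Real.exp_pos _).le
  · -- norm continuity on `(0, τ]`
    exact hexpc'.continuousOn.smul h5
  · -- Lipschitz dependence on the coefficients
    intro B' W' η hB'c hB'β hη hW' hW'c t ht
    set W'γ : ℝ → E →L[ℝ] E := fun r => Real.exp (-(γ * r)) • W' r with hW'γ
    have hW'γop : ∀ r : ℝ, W'γ r = Real.exp (-(γ * r)) • W' r := fun r => rfl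
    have hW'γap : ∀ (r : ℝ) (h : E), W'γ r h = Real.exp (-(γ * r)) • W' r h := fun r h => rfl
    have hW'eq : ∀ (h : E) (r : Icc (0 : ℝ) τ), W'γ r h = Tγ r h -
        ∫ s in (0 : ℝ)..(r : ℝ), Kγ ((r : ℝ) - s) (B' s (W'γ s h)) := by
      intro h r
      have e : (∫ s in (0 : ℝ)..(r : ℝ), Kγ ((r : ℝ) - s) (B' s (W'γ s h))) =
          Real.exp (-(γ * r)) • ∫ s in (0 : ℝ)..(r : ℝ), K ((r : ℝ) - s) (B' s (W' s h)) := by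
        rw [← integral_duhamel_exp_weight K B' (fun s => W' s h) γ r]
        refine intervalIntegral.integral_congr fun s _ => ?_
        simp only [hKγ, hW'γap]
      rw [e, hW'γap, hW' h r, smul_sub, hTγap]
    have hW'c' : ∀ h : E, ContinuousOn (fun r : ℝ => W'γ r h) (Icc 0 τ) := fun h => by
      simp only [hW'γap]
      exact hexpc.continuousOn.smul (hW'c h)
    have key := h6 B' W'γ η hB'c hB'β hη hW'eq hW'c' t ht
    have hdec : W t - W' t = Real.exp (γ * t) • (Wγ t - W'γ t) := by
      rw [smul_sub, hW'γop t, smul_smul, hee t, one_smul, hWop t]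
    calc ‖W t - W' t‖ = Real.exp (γ * t) * ‖Wγ t - W'γ t‖ := by
          rw [hdec, norm_smul, Real.norm_eq_abs, abs_of_pos (Real.exp_pos _)]
      _ ≤ Real.exp (γ * τ) * (4 * (C * γ ^ (-p) * τ ^ (1 - (α + p)) / (1 - (α + p))) * η) :=
          mul_le_mul (heτ t ht) key (norm_nonneg _) (Real.exp_pos _).le
      _ = Real.exp (γ * τ) * (4 * (C * γ ^ (-p) * τ ^ (1 - (α + p)) / (1 - (α + p)))) * η := by
          ring

end Literature.Analysis.UnboundedOperators

end
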